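import Summits.CriticalPhenomena.PercolationContinuityZ3.Theorems.PercNearOneGluingNoHeavyLowerTailAntitheticSlice
import HarnessLib

/-!
# `NoHeavyLowerTail` (stmt-CriticalPhenomena-4575) — antithetic cluster pairs: COROLLARY D1 — the antithetic BHK inequality SC(G,X)
# when every edge at the source is a bridge of `G − X` (prim-hp-2 gen 31/36; MEMO-gen31 §1e, THEOREM-D-disjoint-slice.md Cor. D1,
# MEMO-gen36 §3)

Support file (`--supports stmt-CriticalPhenomena-4575`, hull-port prover `prim-hp-2`, gen 36).  No definitions, no named facts, no sorries;
standard axioms.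

THE ANTITHETIC BHK INEQUALITY SC(G,X) (MEMO-gen29 §3, MEMO-gen31; conjectured for every graph): for increasing `F, G` of the edge cluster,
`0 ≤ Σ_{ω : both clusters of s avoid X} (F(C_s(ω∩E)) − F(C_s(ωᶜ∩E)))·(G(C_s(ω∩E)) − G(C_s(ωᶜ∩E)))`, i.e. conditioned on neither the red nor
the blue cluster of `s` meeting the sink set `X`, the two clusters are concordant on average (equivalently, at `p = ½`,
`E[f(C)g(C) | C, C' ∌ X] ≥ E[f(C)g(C') | C, C' ∌ X]` for the clusters `C, C'` of `s` in a colouring and its complement).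

COROLLARY D1 (gen 31, here a tree theorem): SC(G,X) holds whenever every edge `sa` of `E` is a BRIDGE of `G − X` (removing it from the
edges of `E` that avoid `X` disconnects `s` from `a`) — e.g. `s` pendant, or `G − X` a forest near `s`.  Proof: a vertex `v ≠ s` joined to
`s` by a red path and by a blue path, both avoiding `X`, puts the first edge `sa` of the red path on a closed trail of `G − X` (blue path to
`v`, red path back to `a`), so `sa` is not a bridge; hence the constraint set of SC is the disjoint slice of THEOREM D (`Antithetic.slice_nonneg`).
* `Antithetic.slice_of_bridges` — the slice condition `W ∩ W' = {s}` is automatic under the bridge hypothesis;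
* `Antithetic.sc_nonneg_of_bridges` — COROLLARY D1.
[cite: VandenbergHaggstromKahn2005, Thm. 1.3 (p. 6), §1 p. 3 (open cluster `C_s`)]
-/

noncomputable section

namespace Summit.CriticalPhenomena.PercolationContinuityZ3.Theorems

open Literature.Probability.Percolation
open scoped Classical

namespace Antithetic

section NoCycle

variable {V : Type*}

/-- A vertex on a walk from `s` is reachable from `s`. [folklore] -/
theorem reachable_of_mem_support {H : SimpleGraph V} {s v w : V} (p : H.Walk s v) (hw : w ∈ p.support) : H.Reachable s w := by
  obtain ⟨q, -, -⟩ := SimpleGraph.Walk.mem_support_iff_exists_append.1 hw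
  exact ⟨q⟩

/-- **The slice is automatic under the bridge hypothesis.**  If every edge `sa ∈ E` is a bridge of `G − X` and both clusters of `s` in `ω`
avoid `X`, then no vertex `v ≠ s` is joined to `s` both in `ω ∩ E` and in `ωᶜ ∩ E`. [this work] -/
theorem slice_of_bridges (E : Set (Sym2 V)) (s : V) (X : Set V)
    (hbr : ∀ a, s(s, a) ∈ E → ¬ (openGraph ({e | e ∈ E ∧ ∀ x ∈ X, x ∉ e} \ {s(s, a)})).Reachable s a)
    (ω : Set (Sym2 V)) (hX : ∀ x ∈ X, ¬ (openGraph (ω ∩ E)).Reachable s x ∧ ¬ (openGraph (ωᶜ ∩ E)).Reachable s x) :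
    ∀ v, v ≠ s → ¬ ((openGraph (ω ∩ E)).Reachable s v ∧ (openGraph (ωᶜ ∩ E)).Reachable s v) := by
  rintro v hvs ⟨⟨p⟩, ⟨q⟩⟩
  -- a red PATH from `s` to `v`; its first edge `sa`
  set p₀ := p.bypass with hp₀
  have hpath : p₀.IsPath := p.bypass_isPath
  clear_value p₀
  clear hp₀ p
  cases p₀ with
  | nil => exact hvs rfl
  | @cons _ a _ h p' =>
    rw [SimpleGraph.Walk.cons_isPath_iff] at hpath
    obtain ⟨-, hsp'⟩ := hpath
    rw [openGraph_adj] at h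
    have hsa : s(s, a) ∈ E := h.1.2
    set H := openGraph ({e | e ∈ E ∧ ∀ x ∈ X, x ∉ e} \ {s(s, a)}) with hH
    -- an `η`-open walk whose vertices are not in `X` and which avoids the edge `sa` transfers to `H`
    have htrans : ∀ (η : Set (Sym2 V)) {b c : V} (r : (openGraph (η ∩ E)).Walk b c),
        (∀ w ∈ r.support, w ∉ X) → (∀ e ∈ r.edges, e ≠ s(s, a)) → H.Reachable b c := by
      intro η b c r hXr hne
      refine ⟨r.transfer H fun e he => ?_⟩
      have heG := r.edges_subset_edgeSet he
      rw [openGraph, SimpleGraph.edgeSet_fromEdgeSet] at heG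
      rw [hH, openGraph, SimpleGraph.edgeSet_fromEdgeSet]
      refine ⟨⟨⟨heG.1.2, fun x hx hxe => ?_⟩, hne e he⟩, heG.2⟩
      obtain ⟨y, rfl⟩ := Sym2.mem_iff_exists.1 hxe
      exact hXr x (r.fst_mem_support_of_mem_edges he) hx
    -- the blue walk `q : s → v`
    have h1 : H.Reachable s v := by
      refine htrans ωᶜ q (fun w hw hwX => (hX w hwX).2 (reachable_of_mem_support q hw)) fun e he hea => ?_
      have := q.edges_subset_edgeSet he
      rw [openGraph, SimpleGraph.edgeSet_fromEdgeSet, hea] at this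
      exact this.1.1 h.1.1
    -- the red path tail `p' : a → v`, reversed
    have h2 : H.Reachable v a := by
      refine (htrans ω p' (fun w hw hwX => (hX w hwX).1 ?_) fun e he hea => ?_).symm
      · exact ((openGraph_adj (ω ∩ E) s a).2 h).reachable.trans (reachable_of_mem_support p' hw)
      · have hs : s ∈ e := by rw [hea]; exact Sym2.mem_mk_left s a
        obtain ⟨y, rfl⟩ := Sym2.mem_iff_exists.1 hs
        exact hsp' (p'.fst_mem_support_of_mem_edges he)
    exact hbr a hsa (h1.trans h2)

variable [Fintype V]

/-- **COROLLARY D1 (prim-hp-2 gen 31/36): the antithetic BHK inequality SC(G,X) when every edge at `s` is a bridge of `G − X`.**  For every edge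
set `E` on a finite vertex type, source `s`, sink set `X` such that removing any single edge `sa ∈ E` from the edges of `E` avoiding `X`
disconnects `s` from `a`, and all increasing `F, G` of the edge cluster:
`0 ≤ Σ_{ω : no x ∈ X is joined to s in ω ∩ E or in ωᶜ ∩ E} (F(C_s(ω∩E)) − F(C_s(ωᶜ∩E))) · (G(C_s(ω∩E)) − G(C_s(ωᶜ∩E)))`. [this work] -/
theorem sc_nonneg_of_bridges (E : Set (Sym2 V)) (s : V) (X : Set V)
    (hbr : ∀ a, s(s, a) ∈ E → ¬ (openGraph ({e | e ∈ E ∧ ∀ x ∈ X, x ∉ e} \ {s(s, a)})).Reachable s a)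
    {F G : Set (Sym2 V) → ℝ} (hF : Monotone F) (hG : Monotone G) :
    0 ≤ ∑ ω ∈ Finset.univ.filter (fun ω : Set (Sym2 V) =>
        ∀ x ∈ X, ¬ (openGraph (ω ∩ E)).Reachable s x ∧ ¬ (openGraph (ωᶜ ∩ E)).Reachable s x),
      (F (openEdgeCluster (ω ∩ E) s) - F (openEdgeCluster (ωᶜ ∩ E) s)) *
        (G (openEdgeCluster (ω ∩ E) s) - G (openEdgeCluster (ωᶜ ∩ E) s)) := by
  have hD : (Finset.univ.filter fun ω : Set (Sym2 V) =>
        ∀ x ∈ X, ¬ (openGraph (ω ∩ E)).Reachable s x ∧ ¬ (openGraph (ωᶜ ∩ E)).Reachable s x) =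
      Finset.univ.filter fun ω : Set (Sym2 V) =>
        (∀ v, v ≠ s → ¬ ((openGraph (ω ∩ E)).Reachable s v ∧ (openGraph (ωᶜ ∩ E)).Reachable s v)) ∧
          (∀ x ∈ X, ¬ (openGraph (ω ∩ E)).Reachable s x ∧ ¬ (openGraph (ωᶜ ∩ E)).Reachable s x) :=
    Finset.filter_congr fun ω _ => ⟨fun h => ⟨slice_of_bridges E s X hbr ω h, h⟩, fun h => h.2⟩
  rw [hD]
  exact slice_nonneg E s X hF hG

end NoCycle

end Antithetic

end Summit.CriticalPhenomena.PercolationContinuityZ3.Theorems
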